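import Summits.Parity.BatemanHorn.Theorems.SelbergDelangeRigidityLSDRealSegmentTailsTwoBal
import Literature.NumberTheory.DiophantineApproximation.RidoutIntegers
import HarnessLib

/-!
# Route `SelbergDelangeRigidity`, crux `LSDRealSegment` (stmt-Parity-9770), line
# `product-anatomy-subcritical`: `stub_tailsTwo` conditional on Nair–Tenenbaum alone

The landed conditional form `stub_tailsTwo_of_facts` of the stub `stub_tailsTwo` (the four tilted tail bounds
`APrioriBound`, `RankinTail`, `TopClassBound`, `BalancedClassBound` for Bateman–Horn systems of total degree `2`,
`1 ≤ y < 2`) assumes TWO named facts: (NT) `Literature.NumberTheory.Sieve.NairTenenbaum1998_theorem1` and (R)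
`Literature.NumberTheory.DiophantineApproximation.BugeaudEvertseGyory2018_SPartPolynomialValues`.  The second one is
now PROVED in the tree (`BugeaudEvertseGyory2018_SPartPolynomialValues_holds`, module
`Literature.NumberTheory.DiophantineApproximation.RidoutIntegers`: the `p`-adic Thue–Siegel–Roth theorem for integers
after Ridout, on top of the tree's proof of Roth's theorem), so it is discharged here:

* `stub_tailsTwo_of_NT` (registered helper): the stub's conclusion assuming (NT) only.

Caveat (recorded, not used here): (NT) as rendered in `NairTenenbaumShortSums.lean` is MISSTATED (Erratum 2 there: it
asserts Henriot's range `0 < α < 1`, the printed Theorem 1 gives `0 < α < 1/2`); the re-basing of the whole chain on the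
printed theorem `NairTenenbaum1998_theorem1_printed` is carried out in the sibling files `…TailsTwoPrinted*.lean`.
-/

open Filter Finset Polynomial
open scoped BigOperators Topology Classical

namespace Summit.Parity.BatemanHorn.Cruxes.LSDRealSegment.ProductAnatomySubcritical

open Literature.NumberTheory.Sieve
open Literature.NumberTheory.DiophantineApproximation
open ArithmeticFunction (cardFactors)
noncomputable section

/-- **stub_tailsTwo_of_NT** (registered helper of `stub_tailsTwo`, line `product-anatomy-subcritical`; conditional on the
single named fact (NT) `NairTenenbaum1998_theorem1`, Nair–Tenenbaum 1998 Thm 1 in Henriot's form): all four tail clauses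
of `stub_tailsTwo` hold for every Bateman–Horn system of total degree `2` and every `1 ≤ y < 2`.  Obtained from
`stub_tailsTwo_of_facts` by discharging its second hypothesis (R) with the tree's proof
`BugeaudEvertseGyory2018_SPartPolynomialValues_holds` (Bugeaud–Evertse–Győry 2018, Thm 2.1 (i), proved after Ridout).
[folklore] -/
theorem stub_tailsTwo_of_NT : NairTenenbaum1998_theorem1 →
    ∀ (k : ℕ) (f : Fin k → ℤ[X]), IsBatemanHornSystem f → (∑ i, (f i).natDegree) = 2 → ∀ y : ℝ, 1 ≤ y → y < 2 →
      APrioriBound k f y ∧ RankinTail k f y ∧ TopClassBound k f y ∧ BalancedClassBound k f y :=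
  fun hNT => stub_tailsTwo_of_facts hNT BugeaudEvertseGyory2018_SPartPolynomialValues_holds

end

end Summit.Parity.BatemanHorn.Cruxes.LSDRealSegment.ProductAnatomySubcritical
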